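import Mathlib
import HarnessLib
import Summits.HubbardSuperconductivity.HubbardSuperconductivity.Theorems.KLProgrammeKLRegimeVolumeLimitSixBound
import Summits.HubbardSuperconductivity.HubbardSuperconductivity.Theorems.KLProgrammeKLRegimeVolumeLimitSixRiemannLebesgue
import Summits.HubbardSuperconductivity.HubbardSuperconductivity.Theorems.KLProgrammeThermalGreenHubbardTorusShifted

/-!
# The cutoff-free six-point scalar of the VL child IS minus the two-time Matsubara transform of the half-shifted dressed mode:
# `Six∞_L(n,p) = −∫₀^β e^{ik₀(n)τ}⟨T′_{−p}(τ)T′†_{−p}⟩_{H′}dτ`, and the density is its anticommutator: `occ∞(L) = ⟨{T′,c†}⟩_{H′}`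
# — hence the COUPLING-UNIFORM volume-uniform bound `‖Six∞_L(n,p)‖ ≤ (9/4)β`
# (seat hubbard-kl-k3c5-p1 g5, technique «stub_asm_matsubara suppliers»; VL child `KLRegimeVolumeLimitV14`, stmt-HubbardSuperconductivity-19921)

Objects (k3c5-p3, `…VolumeLimitCutoffFreeDefs`): `occ∞(L) = klOccInf L β U μ = ⟨n_{0↓}⟩_{β,U,μ+U/2,L} − ½`,
`Six∞_L(n,p) = klSixInf L β U μ n p` (the `M = ∞` six-point Matsubara coefficient of the bare carrier), `Σ∞⁰ = U·occ∞ + U²·Six∞`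
(`klSelfEnergyInf_zero_frame`).  Hamiltonian side: `H′ = hubbardTorusWith 2 L 1 U (μ + U/2)`, Bloch modes `c = c_{−p,↑}`, `c†`, the dressed mode
`T = (Σ_z L⁻¹χ_{−p}(z) n_{z↓}c†_{z↑})ᴴ` and its HALF-SHIFT `T′ = T − ½c` (`…ThermalGreenHubbardTorusShifted`, this seat).

* `klSelfEnergyInf_zero_eq_shifted` — for EVERY `U`: `Σ∞⁰_L(n,p) = U·⟨T′c† + c†T′⟩_{H′} − U²·𝒵′(n,p)`,
  `𝒵′(n,p) = ∫₀^β e^{ik₀(n)τ}⟨T′(τ)T′†⟩_{H′}dτ`, `k₀(n) = π(2n+1)/β` — (H1) (`MatsubaraAllU.twoPoint_H1`, k3c4-p2) + k3c5-p2's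
  `klSelfEnergyInf_zero_eq_reamputated` (the carrier is the Hartree-re-amputated Green function) + this seat's exact shifted Schwinger–Dyson
  identity `reamputated_matsubaraGreen_shifted_eq` (no frame factors at the shift `κ = U/2`);
* `klOccInf_eq_gibbsState_shiftedAnticommutator` — `U ≠ 0`: **`occ∞(L) = ⟨T′c† + c†T′⟩_{H′}`** (for every momentum `p`): the label-by-label
  identity `U·occ∞ + U²·Six∞_L(n,p) = U·⟨{T′,c†}⟩ − U²·𝒵′(n,p)` is sent to `n → +∞`, where BOTH Matsubara transforms vanish by Riemann–Lebesgue
  (`tendsto_klSixInf_atTop`, `tendsto_matsubaraTransform_pos_atTop`, `…SixRiemannLebesgue`) — no anticommutator is computed;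
* `klSixInf_eq_neg_shiftedDressedMatsubara` — `U ≠ 0`: **`Six∞_L(n,p) = −𝒵′(n,p)`** for every Matsubara integer `n`;
* `norm_klSixInf_le_beta` — `U ≠ 0`: **`‖Six∞_L(n,p)‖ ≤ (9/4)·β`** for every `L ≥ 3`, `n`, `p`, `μ` — uniform in the volume, the label, the
  momentum AND the coupling (the bound of `…VolumeLimitSixBound` was `(BH(β,U) + (3/2)|U|)/U² ≳ 4/|U|`); `sixBound_couplingUniform` packages it.

(The registered stub `stub_vl_sixBound` of 19921 is the landed `stub_vl_sixBound_holds` of `…VolumeLimitSixBound`, same type; the gate's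
`dedup.landed` rule refuses a by-name restatement, so the skeleton's composition cites that declaration directly.)

So the (b2) object of `stub_vl_rates` is a thermal two-time function of ONE volume-uniformly bounded quasi-fermion mode (`‖T′‖ ≤ 3/2`):
its two-volume rate is a statement about `⟨T′_{−p}(τ)T′†_{−p}⟩_{H′,L}` alone.  Everything is proved; no definition.
-/

noncomputable section

namespace Summit.HubbardSuperconductivity.HubbardSuperconductivity.Theorems.TwoPointAssembly

set_option linter.dupNamespace false -- summit = problem name (single-conjunct summit), D-0017

open Finset Filter Topology MeasureTheory intervalIntegral Complex Literature.MathematicalPhysics.QuantumLattice Literature.Probability.LatticeModels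
  GrassmannAlgebra
open Summit.HubbardSuperconductivity.HubbardSuperconductivity.Theorems.ThermalGreen
open Summit.HubbardSuperconductivity.HubbardSuperconductivity.Theorems.MatsubaraAllU
open Summit.HubbardSuperconductivity.HubbardSuperconductivity.Theorems.KLRegimeSplit
open Summit.HubbardSuperconductivity.HubbardSuperconductivity.Theorems.KLProgrammeLegKernels
open scoped ComplexConjugate ComplexOrder Matrix.Norms.L2Operator Matrix

variable {L : ℕ} [NeZero L]

/-! ## §1 The bare cutoff-free carrier in the Hartree-shifted Schwinger–Dyson form (every coupling) -/

/-- The denominator of the Hartree-re-amputated proxy in the letters of `…ThermalGreenHubbardTorusShifted`: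
`−ik₀(n) + e⁰(p) = −ik₀(n) + (ε_L(−p) − (μ + U/2) + U/2)`. -/
theorem proxyDen_eq_shifted (β U μ : ℝ) (n : ℤ) (p : TorusSite 2 L) :
    (-Complex.I * ((Real.pi * (2 * (n : ℝ) + 1) / β : ℝ) : ℂ) + ((nambuXiCT L μ 0 p : ℝ) : ℂ)) =
      -I * ((Real.pi * (2 * (n : ℝ) + 1) / β : ℝ) : ℂ) + ((torusBand L (-p) - (μ + U / 2) + U / 2 : ℝ) : ℂ) := by
  rw [nambuXiCT_zero_frame, nambuXi, torusBand_neg]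
  push_cast
  ring

/-- **`Σ∞⁰_L(n,p) = U·⟨T′c† + c†T′⟩_{H′} − U²·𝒵′(n,p)` for EVERY coupling** (`L ≥ 3`, `β > 0`): (H1) + the Hartree re-amputation + the shifted
Schwinger–Dyson identity. -/
theorem klSelfEnergyInf_zero_eq_shifted (hL : 3 ≤ L) {β : ℝ} (hβ : 0 < β) (U μ : ℝ) (n : ℤ) (p : TorusSite 2 L) :
    klSelfEnergyInf L β U μ 0 n p =
      (U : ℂ) * Matrix.gibbsState β (hubbardTorusWith 2 L 1 U (μ + U / 2)) (((∑ z : FermionTorus 2 L, (torusFourierWeight 2 L * torusChar (-p) z.toTorusSite) • (numberOp z 1 * creation (orb z 0)))ᴴ - (1 / 2 : ℂ) • momentumAnnihilation (-p) 0) * momentumCreation (-p) 0 + momentumCreation (-p) 0 * ((∑ z : FermionTorus 2 L, (torusFourierWeight 2 L * torusChar (-p) z.toTorusSite) • (numberOp z 1 * creation (orb z 0)))ᴴ - (1 / 2 : ℂ) • momentumAnnihilation (-p) 0)) -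
        (U : ℂ) ^ 2 * ∫ τ in (0 : ℝ)..β, cexp (I * ((Real.pi * (2 * (n : ℝ) + 1) / β : ℝ) : ℂ) * τ) * Matrix.gibbsState β (hubbardTorusWith 2 L 1 U (μ + U / 2)) (Matrix.imagTimeEvolve (hubbardTorusWith 2 L 1 U (μ + U / 2)) (τ : ℂ) ((∑ z : FermionTorus 2 L, (torusFourierWeight 2 L * torusChar (-p) z.toTorusSite) • (numberOp z 1 * creation (orb z 0)))ᴴ - (1 / 2 : ℂ) • momentumAnnihilation (-p) 0) * ((∑ z : FermionTorus 2 L, (torusFourierWeight 2 L * torusChar (-p) z.toTorusSite) • (numberOp z 1 * creation (orb z 0)))ᴴ - (1 / 2 : ℂ) • momentumAnnihilation (-p) 0)ᴴ) := by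
  rw [klSelfEnergyInf_zero_eq_reamputated hL hβ U μ (twoPoint_H1 β hβ U μ L hL) n p, proxyDen_eq_shifted]
  have h := reamputated_matsubaraGreen_shifted_eq hL U (μ + U / 2) β (-p) (cexp_fermiMatsubara_mul_beta hβ.ne' n)
  simp only [fermiMatsubara] at h
  exact h

/-! ## §2 Separation of the density by Riemann–Lebesgue in the label (`U ≠ 0`) -/

/-- **`occ∞(L) = ⟨T′_{−p}c†_{−p} + c†_{−p}T′_{−p}⟩_{H′}`** (`U ≠ 0`, `L ≥ 3`, `β > 0`; every momentum `p`): both sides are the `n → ∞` limit of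
`U⁻¹·Σ∞⁰_L(n,p)`, the six-point and the dressed two-time Matsubara transforms vanishing by Riemann–Lebesgue. -/
theorem klOccInf_eq_gibbsState_shiftedAnticommutator (hL : 3 ≤ L) {β : ℝ} (hβ : 0 < β) {U : ℝ} (hU : U ≠ 0) (μ : ℝ) (p : TorusSite 2 L) :
    klOccInf L β U μ = Matrix.gibbsState β (hubbardTorusWith 2 L 1 U (μ + U / 2)) (((∑ z : FermionTorus 2 L, (torusFourierWeight 2 L * torusChar (-p) z.toTorusSite) • (numberOp z 1 * creation (orb z 0)))ᴴ - (1 / 2 : ℂ) • momentumAnnihilation (-p) 0) * momentumCreation (-p) 0 + momentumCreation (-p) 0 * ((∑ z : FermionTorus 2 L, (torusFourierWeight 2 L * torusChar (-p) z.toTorusSite) • (numberOp z 1 * creation (orb z 0)))ᴴ - (1 / 2 : ℂ) • momentumAnnihilation (-p) 0)) := by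
  have hUc : (U : ℂ) ≠ 0 := Complex.ofReal_ne_zero.mpr hU
  -- the two expressions of `Σ∞⁰_L(n,p)` along `n → +∞`
  have hA : Tendsto (fun m : ℕ => klSelfEnergyInf L β U μ 0 (m : ℤ) p) atTop (𝓝 ((U : ℂ) * klOccInf L β U μ + (U : ℂ) ^ 2 * 0)) := by
    have h := (tendsto_klSixInf_atTop (L := L) hβ U μ p).const_mul ((U : ℂ) ^ 2) |>.const_add ((U : ℂ) * klOccInf L β U μ)
    refine h.congr fun m => ?_
    rw [klSelfEnergyInf_zero_frame hβ.ne']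
  have hB : Tendsto (fun m : ℕ => klSelfEnergyInf L β U μ 0 (m : ℤ) p) atTop
      (𝓝 ((U : ℂ) * Matrix.gibbsState β (hubbardTorusWith 2 L 1 U (μ + U / 2)) (((∑ z : FermionTorus 2 L, (torusFourierWeight 2 L * torusChar (-p) z.toTorusSite) • (numberOp z 1 * creation (orb z 0)))ᴴ - (1 / 2 : ℂ) • momentumAnnihilation (-p) 0) * momentumCreation (-p) 0 + momentumCreation (-p) 0 * ((∑ z : FermionTorus 2 L, (torusFourierWeight 2 L * torusChar (-p) z.toTorusSite) • (numberOp z 1 * creation (orb z 0)))ᴴ - (1 / 2 : ℂ) • momentumAnnihilation (-p) 0)) - (U : ℂ) ^ 2 * 0)) := by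
    have h := ((tendsto_matsubaraTransform_pos_atTop
      (fun τ : ℝ => Matrix.gibbsState β (hubbardTorusWith 2 L 1 U (μ + U / 2)) (Matrix.imagTimeEvolve (hubbardTorusWith 2 L 1 U (μ + U / 2)) (τ : ℂ) ((∑ z : FermionTorus 2 L, (torusFourierWeight 2 L * torusChar (-p) z.toTorusSite) • (numberOp z 1 * creation (orb z 0)))ᴴ - (1 / 2 : ℂ) • momentumAnnihilation (-p) 0) * ((∑ z : FermionTorus 2 L, (torusFourierWeight 2 L * torusChar (-p) z.toTorusSite) • (numberOp z 1 * creation (orb z 0)))ᴴ - (1 / 2 : ℂ) • momentumAnnihilation (-p) 0)ᴴ)) hβ.le hβ).const_mul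
        ((U : ℂ) ^ 2)).const_sub ((U : ℂ) * Matrix.gibbsState β (hubbardTorusWith 2 L 1 U (μ + U / 2)) (((∑ z : FermionTorus 2 L, (torusFourierWeight 2 L * torusChar (-p) z.toTorusSite) • (numberOp z 1 * creation (orb z 0)))ᴴ - (1 / 2 : ℂ) • momentumAnnihilation (-p) 0) * momentumCreation (-p) 0 + momentumCreation (-p) 0 * ((∑ z : FermionTorus 2 L, (torusFourierWeight 2 L * torusChar (-p) z.toTorusSite) • (numberOp z 1 * creation (orb z 0)))ᴴ - (1 / 2 : ℂ) • momentumAnnihilation (-p) 0)))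
    refine h.congr fun m => ?_
    rw [klSelfEnergyInf_zero_eq_shifted hL hβ U μ (m : ℤ) p]
  have heq := tendsto_nhds_unique hA hB
  simp only [mul_zero, add_zero, sub_zero] at heq
  exact mul_left_cancel₀ hUc heq

/-- **`Six∞_L(n,p) = −𝒵′(n,p)`** (`U ≠ 0`, `L ≥ 3`, `β > 0`; every Matsubara integer `n` and torus momentum `p`): the cutoff-free six-point scalar is minus
the two-time Matsubara transform of the half-shifted dressed mode. -/
theorem klSixInf_eq_neg_shiftedDressedMatsubara (hL : 3 ≤ L) {β : ℝ} (hβ : 0 < β) {U : ℝ} (hU : U ≠ 0) (μ : ℝ) (n : ℤ) (p : TorusSite 2 L) :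
    klSixInf L β U μ n p = -(∫ τ in (0 : ℝ)..β, cexp (I * ((Real.pi * (2 * (n : ℝ) + 1) / β : ℝ) : ℂ) * τ) * Matrix.gibbsState β (hubbardTorusWith 2 L 1 U (μ + U / 2)) (Matrix.imagTimeEvolve (hubbardTorusWith 2 L 1 U (μ + U / 2)) (τ : ℂ) ((∑ z : FermionTorus 2 L, (torusFourierWeight 2 L * torusChar (-p) z.toTorusSite) • (numberOp z 1 * creation (orb z 0)))ᴴ - (1 / 2 : ℂ) • momentumAnnihilation (-p) 0) * ((∑ z : FermionTorus 2 L, (torusFourierWeight 2 L * torusChar (-p) z.toTorusSite) • (numberOp z 1 * creation (orb z 0)))ᴴ - (1 / 2 : ℂ) • momentumAnnihilation (-p) 0)ᴴ)) := by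
  have hUc : (U : ℂ) ^ 2 ≠ 0 := pow_ne_zero _ (Complex.ofReal_ne_zero.mpr hU)
  have h1 := klSelfEnergyInf_zero_eq_shifted hL hβ U μ n p
  rw [klSelfEnergyInf_zero_frame hβ.ne', klOccInf_eq_gibbsState_shiftedAnticommutator hL hβ hU μ p] at h1
  -- `U·m + U²·Six = U·m − U²·𝒵′`
  have h2 : (U : ℂ) ^ 2 * klSixInf L β U μ n p = (U : ℂ) ^ 2 * -(∫ τ in (0 : ℝ)..β, cexp (I * ((Real.pi * (2 * (n : ℝ) + 1) / β : ℝ) : ℂ) * τ) * Matrix.gibbsState β (hubbardTorusWith 2 L 1 U (μ + U / 2)) (Matrix.imagTimeEvolve (hubbardTorusWith 2 L 1 U (μ + U / 2)) (τ : ℂ) ((∑ z : FermionTorus 2 L, (torusFourierWeight 2 L * torusChar (-p) z.toTorusSite) • (numberOp z 1 * creation (orb z 0)))ᴴ - (1 / 2 : ℂ) • momentumAnnihilation (-p) 0) * ((∑ z : FermionTorus 2 L, (torusFourierWeight 2 L * torusChar (-p) z.toTorusSite) • (numberOp z 1 * creation (orb z 0)))ᴴ - (1 / 2 : ℂ) •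 momentumAnnihilation (-p) 0)ᴴ)) := by
    linear_combination h1
  exact mul_left_cancel₀ hUc h2

/-! ## §3 The coupling-uniform bound -/

/-- **`‖Six∞_L(n,p)‖ ≤ (9/4)·β`** for `U ≠ 0`, every `L ≥ 3`, `β > 0`, `μ`, Matsubara integer `n`, torus momentum `p` — uniform in the volume, the
label, the momentum AND the coupling (`‖T′‖ ≤ 3/2` and the Gibbs two-time bound). -/
theorem norm_klSixInf_le_beta (hL : 3 ≤ L) {β : ℝ} (hβ : 0 < β) {U : ℝ} (hU : U ≠ 0) (μ : ℝ) (n : ℤ) (p : TorusSite 2 L) :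
    ‖klSixInf L β U μ n p‖ ≤ 9 / 4 * β := by
  rw [klSixInf_eq_neg_shiftedDressedMatsubara hL hβ hU μ n p, norm_neg]
  exact norm_shiftedDressedMatsubara_le U (μ + U / 2) hβ.le (-p) _

/-- **(b3), COUPLING-UNIFORM PACKAGED FORM**: for every `β > 0` there is ONE bound (`B = 9β/4`) for all `U ≠ 0`, `μ`, `L ≥ 3`, `n`, `p`. -/
theorem sixBound_couplingUniform {β : ℝ} (hβ : 0 < β) :
    ∃ B : ℝ, ∀ (U : ℝ), U ≠ 0 → ∀ (μ : ℝ) (L : ℕ) [NeZero L], 3 ≤ L → ∀ (n : ℤ) (p : TorusSite 2 L), ‖klSixInf L β U μ n p‖ ≤ B :=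
  ⟨9 / 4 * β, fun _ hU μ _ _ hL n p => norm_klSixInf_le_beta hL hβ hU μ n p⟩

end Summit.HubbardSuperconductivity.HubbardSuperconductivity.Theorems.TwoPointAssembly

end
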